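import Summits.BirchSwinnertonDyer.Rank1Residual.X2.IsogenySelmerGroup
import HarnessLib

/-!
# `Sel^{(φ)}(E/K) ↠ Ш(E/K)[φ]`: the fundamental exact sequence of a `K`-isogeny, completed
# (Silverman X.4.2(a)) — `#Sel^{(φ)}(E/K) = #(E'(K̄)^Γ/φ(E(K̄)^Γ)) · #Ш(E/K)[φ]`
# (cell `b2b-bsdres`, unit `b2b-bsdres-eisenstein-p2`, gen 24; sequel of `X2/IsogenySelmerGroup.lean`)

HONEST FRAMING (run/shared/lean/b2b/bsd-rank1-residual/, verbatim in every file): the goal of the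
cell is to DELETE the COMBINATION-SHAPED residual classes of the Birch–Swinnerton-Dyer formula for
ALL analytic-rank `≤ 1` elliptic curves over `ℚ` — "full BSD formula for every rank `≤ 1` curve in
class `C`" assembled STRICTLY from published theorems — so that the rank-`≤ 1` remainder becomes
exactly the CONSTRUCTION-SHAPED classes, which are TYPED (missing-input `Prop`s), NOT attempted.
This is not "finishing BSD". Research route; NO CLAIM BEYOND STATED CLASSES; nothing here changes a
label; nothing is booked. Definitions with bodies + theorems; no named fact.

WHAT. `X2/IsogenySelmerGroup.lean` proved the two inclusions a LOWER bound for `Ш` needs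
(`ker(H¹(K,E[φ]) → H¹(K,E)) ≤ Sel^{(φ)}`, `Sel^{(φ)} → Ш(E/K)`). This file adds the other half of
Silverman X.4.2(a): the image of `Sel^{(φ)}(E/K)` in `H¹(K, E)` is EXACTLY `Ш(E/K)[φ]`, the kernel
of `φ_* : Ш(E/K) → H¹(K, E')` — so `0 → E'(K)/φ(E(K)) → Sel^{(φ)}(E/K) → Ш(E/K)[φ] → 0` is exact
and `#Sel^{(φ)}(E/K) = #(E'(K̄)^{Γ_K}/φ(E(K̄)^{Γ_K})) · #Ш(E/K)[φ]`. The UPPER-bound use: an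
isogeny descent with `Sel^{(φ)}(E/K) = E'(K)/φ(E(K))` (no excess) certifies `Ш(E/K)[φ] = 0` (the
shape of the lane's rank-one `3`-descent certificates, x1b `X1ThreeDescentCertificate`).
* `isogenyPushH1 φ : H¹(K, E) → H¹(K, E')` (`φ_*`), `shaKer φ = Ш(E/K) ⊓ ker φ_*` (`Ш(E/K)[φ]`);
* `isogenyPushH1_kernelToH1` (`φ_* ∘ ι_* = 0`), `map_kernelToH1_isogenySelmerGroup_le_shaKer`,
  `shaKer_le_map_kernelToH1_isogenySelmerGroup` (a class of `Ш` killed by `φ_*` lifts to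
  `H¹(K, E[φ])` — generic exactness `ResidualDevissage.mem_range_pushH1_of_pushH1_eq_zero` — and ANY
  lift is Selmer, by the cocycle criterion), **`map_kernelToH1_isogenySelmerGroup_eq_shaKer`**;
* **`natCard_isogenySelmerGroup_eq_mul_natCard_shaKer`** and the certificate reading
  `natCard_shaKer_eq_one_of_card_eq` (`#Sel^{(φ)} = #(E'(K̄)^Γ/φ(E(K̄)^Γ))` ⇒ `Ш(E/K)[φ]` trivial).

References: Silverman, *AEC*, X.4.1–X.4.2(a); Serre, *Galois Cohomology*, I.§5.1.
-/

noncomputable section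
open scoped Classical
universe u

namespace Summit.BirchSwinnertonDyer.Rank1Residual.X2.IsogenySelmerSha

open WeierstrassCurve Literature.NumberTheory.EllipticCurves
  Literature.NumberTheory.GaloisRepresentations NumberField IsDedekindDomain
  Summit.BirchSwinnertonDyer.Rank1Residual.X2.ResidualDevissageModules
  Summit.BirchSwinnertonDyer.Rank1Residual.X2.TorsionComparison
  Summit.BirchSwinnertonDyer.Rank1Residual.X2.ConnectingHomomorphism
  Summit.BirchSwinnertonDyer.Rank1Residual.X2.IsogenySelmerGroup

variable {K : Type u} [Field K] {W W' : WeierstrassCurve K}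

/-! ## §1. `φ_* : H¹(K, E) → H¹(K, E')` and `Ш(E/K)[φ]` -/

/-- Equivariance of `φ` in the shape consumed by `resH1Hom (ContinuousMonoidHom.id _)`. [folklore] -/
theorem isogeny_smul_id (φ : Isogeny W W') (σ : Field.absoluteGaloisGroup K) (P : W.geomPoints) :
    φ.toAddMonoidHom (ContinuousMonoidHom.id _ σ • P) = σ • φ.toAddMonoidHom P :=
  isogeny_smul φ σ P

/-- **`φ_* : H¹(K, E) → H¹(K, E')`**, the map induced by the isogeny on `K̄`-points.
Silverman, *AEC*, X.4.1. [folklore] -/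
def isogenyPushH1 (φ : Isogeny W W') : W.galH1 →+ W'.galH1 :=
  resH1Hom (ContinuousMonoidHom.id _) φ.toAddMonoidHom (isogeny_smul_id φ)

/-- `φ_* ∘ (E[φ] ↪ E)_* = 0` on `H¹` (the composite `E[φ] → E → E'` is zero).
Silverman, *AEC*, X.4.1. [folklore] -/
theorem isogenyPushH1_kernelToH1 (φ : Isogeny W W') (c : galH1Kernel φ) :
    isogenyPushH1 φ (kernelToH1 φ c) = 0 :=
  ResidualDevissage.pushH1_pushH1_eq_zero (hi := (kernelModule φ).incl_smul_id)
    (hq := isogeny_smul_id φ) (apply_incl_eq_zero φ) c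

section NumberField

variable [NumberField K]

/-- **`Ш(E/K)[φ] = Ш(E/K) ∩ ker φ_*`**, the `φ`-torsion of the Tate–Shafarevich group
(Silverman X.4.2(a): the right-hand term of the `φ`-descent sequence). [cite: SilvermanAEC2009, X.4.1–4.2] -/
def shaKer (φ : Isogeny W W') : AddSubgroup W.galH1 :=
  W.sha ⊓ (isogenyPushH1 φ).ker

/-- Membership in `Ш(E/K)[φ]`. [cite: SilvermanAEC2009, X.4.1–4.2] -/
theorem mem_shaKer_iff (φ : Isogeny W W') (c : W.galH1) :
    c ∈ shaKer φ ↔ c ∈ W.sha ∧ isogenyPushH1 φ c = 0 := by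
  rw [shaKer, AddSubgroup.mem_inf, AddMonoidHom.mem_ker]

/-! ## §2. The image of `Sel^{(φ)}` is exactly `Ш(E/K)[φ]` -/

/-- `Sel^{(φ)}(E/K)` maps into `Ш(E/K)[φ]`. [cite: SilvermanAEC2009, X.4.1–4.2] -/
theorem map_kernelToH1_isogenySelmerGroup_le_shaKer (φ : Isogeny W W') :
    (isogenySelmerGroup φ).map (kernelToH1 φ) ≤ shaKer φ := by
  intro c hc
  refine (mem_shaKer_iff φ c).2 ⟨map_kernelToH1_isogenySelmerGroup_le_sha φ hc, ?_⟩
  obtain ⟨c', -, rfl⟩ := hc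
  exact isogenyPushH1_kernelToH1 φ c'

variable [W.IsElliptic] [W'.IsElliptic]

/-- **Every class of `Ш(E/K)[φ]` is the image of a `φ`-Selmer class.** A class `c ∈ H¹(K, E)`
killed by `φ_*` lifts to `H¹(K, E[φ])` (exactness of `H¹(K, E[φ]) → H¹(K, E) → H¹(K, E')`, generic:
`ResidualDevissage.mem_range_pushH1_of_pushH1_eq_zero`, with `φ` onto `E'(K̄)`), and ANY lift of a
class of `Ш(E/K)` is `φ`-Selmer: the local conditions of `Sel^{(φ)}` are conditions on the image in
`H¹(K_v, E)`, read through the cocycle criterion. [cite: SilvermanAEC2009, X.4.1–4.2] -/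
theorem shaKer_le_map_kernelToH1_isogenySelmerGroup (φ : Isogeny W W') :
    shaKer φ ≤ (isogenySelmerGroup φ).map (kernelToH1 φ) := by
  intro c hc
  obtain ⟨hsha, hker⟩ := (mem_shaKer_iff φ c).1 hc
  -- lift `c` to `H¹(K, E[φ])`
  have hrange : c ∈ (kernelToH1 φ).range :=
    ResidualDevissage.mem_range_pushH1_of_pushH1_eq_zero (hi := (kernelModule φ).incl_smul_id)
      (hq := isogeny_smul_id φ) (continuous_smul_geomPoints W) (kernelModule φ).incl_injective
      φ.surjective (mem_range_incl_of_apply_eq_zero φ) hker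
  obtain ⟨c', rfl⟩ := hrange
  refine ⟨c', ?_, rfl⟩
  -- any lift is Selmer: the local criterion for `c'` is the local criterion for `kernelToH1 φ c'`
  obtain ⟨f, rfl⟩ := classHom_surjective (G := Field.absoluteGaloisGroup K)
    (M := (kernelModule φ).Sub) c'
  have key : ∀ (E : Type u) [Field E] [Algebra K E],
      kernelToH1 φ (classHom _ _ f) ∈ W.localRestrictionKer E →
        classHom _ _ f ∈ isogenySelmerLocalKer E φ := by
    intro E _ _ h
    rw [classHom_apply, kernelToH1, ResidualDevissage.pushH1_oneCocycleClass, localRestrictionKer,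
      oneCocycleClass_mem_resKer_iff] at h
    obtain ⟨a, ha⟩ := h
    rw [classHom_apply, isogenySelmerLocalKer, oneCocycleClass_mem_resKer_iff]
    exact ⟨a, fun x ↦ ha x⟩
  rw [SetLike.mem_coe, mem_isogenySelmerGroup_iff]
  rw [W.mem_sha_iff] at hsha
  exact ⟨fun v ↦ key _ (hsha.1 v), fun w ↦ key _ (hsha.2 w)⟩

/-- **The image of `Sel^{(φ)}(E/K)` in `H¹(K, E)` is exactly `Ш(E/K)[φ]`** (Silverman X.4.2(a): the
`φ`-descent sequence `0 → E'(K)/φ(E(K)) → Sel^{(φ)}(E/K) → Ш(E/K)[φ] → 0` is exact on the right).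
[cite: SilvermanAEC2009, X.4.2(a)] -/
theorem map_kernelToH1_isogenySelmerGroup_eq_shaKer (φ : Isogeny W W') :
    (isogenySelmerGroup φ).map (kernelToH1 φ) = shaKer φ :=
  le_antisymm (map_kernelToH1_isogenySelmerGroup_le_shaKer φ)
    (shaKer_le_map_kernelToH1_isogenySelmerGroup φ)

/-! ## §3. `#Sel^{(φ)}(E/K) = #(E'(K̄)^Γ/φ(E(K̄)^Γ)) · #Ш(E/K)[φ]` -/

/-- **`#Sel^{(φ)}(E/K) = #(E'(K̄)^{Γ_K}/φ(E(K̄)^{Γ_K})) · #Ш(E/K)[φ]`** — Silverman X.4.2(a) in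
counting form (`E'(K̄)^{Γ_K} = E'(K)` by Galois descent, `X2/IsogenySelmerCertificate`).
[cite: SilvermanAEC2009, X.4.2(a)] -/
theorem natCard_isogenySelmerGroup_eq_mul_natCard_shaKer (φ : Isogeny W W') :
    Nat.card (isogenySelmerGroup φ) =
      Nat.card (invariants (Field.absoluteGaloisGroup K) W'.geomPoints ⧸
          qInvariants (Field.absoluteGaloisGroup K) (q := φ.toAddMonoidHom) (isogeny_smul φ)) *
        Nat.card (shaKer φ) := by
  rw [natCard_isogenySelmerGroup_eq, map_kernelToH1_isogenySelmerGroup_eq_shaKer]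

/-- **No-excess certificate: `#Sel^{(φ)}(E/K) = #(E'(K̄)^Γ/φ(E(K̄)^Γ))` (finite, nonzero) forces
`Ш(E/K)[φ]` to be trivial** (`#Ш(E/K)[φ] = 1`) — the reading of an isogeny descent "with
`Sel^{(φ)} = E'(K)/φ(E(K))`" (x1b's rank-one `3`-descent certificates). [cite: SilvermanAEC2009, X.4.2(a)] -/
theorem natCard_shaKer_eq_one_of_card_eq (φ : Isogeny W W')
    (h : Nat.card (isogenySelmerGroup φ) =
      Nat.card (invariants (Field.absoluteGaloisGroup K) W'.geomPoints ⧸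
        qInvariants (Field.absoluteGaloisGroup K) (q := φ.toAddMonoidHom) (isogeny_smul φ)))
    (h0 : Nat.card (isogenySelmerGroup φ) ≠ 0) : Nat.card (shaKer φ) = 1 := by
  have hmul := natCard_isogenySelmerGroup_eq_mul_natCard_shaKer φ
  rw [h] at hmul h0
  -- `Q = Q * #Ш[φ]` with `Q ≠ 0`
  have hQ : 0 < Nat.card (invariants (Field.absoluteGaloisGroup K) W'.geomPoints ⧸
      qInvariants (Field.absoluteGaloisGroup K) (q := φ.toAddMonoidHom) (isogeny_smul φ)) :=
    Nat.pos_of_ne_zero h0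
  have := Nat.eq_of_mul_eq_mul_left hQ (hmul.symm.trans (mul_one _).symm)
  exact this

end NumberField

end Summit.BirchSwinnertonDyer.Rank1Residual.X2.IsogenySelmerSha

end
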